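import Mathlib
import Literature.Computability.AlgebraicComplexity.ValiantCompleteness
import Literature.Computability.AlgebraicComplexity.ValiantHCCompleteness
import Literature.Computability.AlgebraicComplexity.PermanentVsDeterminant
import Literature.Computability.AlgebraicComplexity.DeterminantalComplexityProofs
import Summits.PneNP.PneNP.Theses.ConvexRankGates
import Summits.PneNP.PneNP.Theorems.LinAlgGateBlind.Negative.ValiantCertificate
import Summits.PneNP.PneNP.Theorems.ConvexRankGatesLinAlgGateBlindCliqueVNP

/-!
# Route ConvexRankGates — crux `LinAlgGateBlind` (stmt-PneNP-10681), support:
# the crux as typed implies Valiant's hypothesis (permanent versus determinant) and `VNP ⊄ VBP` in every characteristic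

Lead prover of the crux chain (line `dnf-invariant-wide-gates-see-small-cliques`, 2026-08-16). The standing
disprover's kernel-checked certificate `Theorems/LinAlgGateBlind/Negative/ValiantCertificate.lean`
(`determinantalComplexity_cliquePoly_of_linAlgGateBlind`) says that the crux
`Summit.PneNP.PneNP.Theses.ConvexRankGates.LinAlgGateBlind` — no polynomial-size monotone circuit over
`{∧₂, ∨₂} ∪ PERM_{m^c} ∪ GRANK_{m^c}` computes `CLIQUE(m, ⌈m^δ⌉)`, GRANK gates over ANY field with arbitrary constants —
forces `dc(CL_{m,⌈m^δ⌉}) > m^c` eventually, for every `c`, over every field. With the `VNP`-membership of the clique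
family (`exists_isVNPFamily_cliquePoly`, `ConvexRankGatesLinAlgGateBlindCliqueVNP.lean`), the tree's Valiant completeness
theorems (`isVNPComplete_perPoly_holds`: PER is `VNP`-complete in characteristic `≠ 2`; `isVNPComplete_hcPoly_holds`: HC
is `VNP`-complete over every field) and the monotonicity of `dc` under projections
(`determinantalComplexity_le_of_isProjection_holds`), this file carries the certificate to NAMED statements:

* `not_isPBounded_dc_cliquePoly_of_linAlgGateBlind` — the crux forbids p-bounded `dc(CL_{n,⌈n^δ⌉})` over every field;
* `isPBounded_dc_cliquePoly_of_perPoly` / `…_of_hcPoly` — p-bounded `dc(PER)` (char `≠ 2`) resp. `dc(HC)` (any field)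
  forces p-bounded `dc(CL_{·, κ ·})` for every schedule `κ` with `κ n ≥ 2` for `n ≥ 2`;
* **`dcPerSuperpolynomial_of_linAlgGateBlind`** — the crux implies `DcPerSuperpolynomial F` (pnp.S05: `dc(PER_n)` is not
  polynomially bounded; `Literature/…/PermanentVsDeterminant.lean`) over every field `F` of characteristic `≠ 2`;
* **`dcPerSuperpolynomialComplex_of_linAlgGateBlind`** — in particular the crux implies VALIANT'S HYPOTHESIS
  `DcPerSuperpolynomialComplex` (Valiant 1979; Landsberg 2017, Conj. 1.2.4.2), a registered OPEN statement of the tree;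
* **`dc_hcPoly_not_isPBounded_of_linAlgGateBlind`** — over EVERY field `F` (characteristic `2` included) the crux implies
  that `dc(HC_n)` is not polynomially bounded, i.e. `VNP_F ⊄ VBP_F`.

So whoever proves crux #4 of the route as typed proves `VNP ⊄ VBP` in every characteristic. This is the formal content of
the chain's standing verdict "every line over the full (wild-constant) GRANK basis is Valiant-hard" (triage r1-1/2/3,
Disproof headline), on which the lead's line verdicts rest; it does not touch the PERM door nor the tame-GRANK re-typing.
-/

set_option linter.dupNamespace false  -- `Summit.PneNP.PneNP.…` is the harness-mandated namespace (summit = sub-problem)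

namespace Summit.PneNP.PneNP.Theorems.LinAlgGateBlindValiant

open Filter Literature.Computability.Complexity Literature.Computability.AlgebraicComplexity
open Summit.PneNP.PneNP.Theorems.LinAlgGateBlind.Negative (cliquePoly determinantalComplexity_cliquePoly_of_linAlgGateBlind)

/- `dc` below is `Literature.Computability.AlgebraicComplexity.determinantalComplexity` (the spelling of `DcPerSuperpolynomial`;
`Literature.Computability.Complexity.determinantalComplexity` is a definitionally equal duplicate we never mention). -/
local notation "dc" => Literature.Computability.AlgebraicComplexity.determinantalComplexity

noncomputable section

/-! ### §1 Transfer of p-bounded determinantal complexity along `VNP`-completeness -/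

section Transfer

variable (F : Type) [Field F]

/-- p-bounded `dc` transfers down a p-projection (`dc` is monotone under projections, Bürgisser 2000 §2.5). [folklore] -/
theorem isPBounded_dc_of_isPProjection {τ σ : ℕ → Type} {g : ∀ n, MvPolynomial (τ n) F}
    {f : ∀ n, MvPolynomial (σ n) F} (hgf : IsPProjection g f) (hf : IsPBounded fun n => dc (f n)) :
    IsPBounded fun n => dc (g n) := by
  obtain ⟨t, ht, hproj⟩ := hgf
  exact (IsPBounded.comp_holds hf ht).mono fun n => determinantalComplexity_le_of_isProjection_holds (hproj n)

/-- If `g` eventually coincides with the clique polynomials, p-bounded `dc(g)` gives p-bounded `dc(CL)`. [folklore] -/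
theorem isPBounded_dc_cliquePoly_of_eventuallyEq (κ : ℕ → ℕ) (hκ : ∀ n ≥ 2, 2 ≤ κ n)
    {g : ∀ n, MvPolynomial (Fin (CliqueLPGate.nE n)) F} (hg : ∀ n, 2 ≤ κ n → g n = cliquePoly n F (κ n))
    (h : IsPBounded fun n => dc (g n)) : IsPBounded fun n => dc (cliquePoly n F (κ n)) := by
  obtain ⟨c, hc⟩ := h
  set A := dc (cliquePoly 0 F (κ 0)) with hA
  set B := dc (cliquePoly 1 F (κ 1)) with hB
  refine ⟨c + A + B, fun n => ?_⟩
  dsimp only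
  rcases Nat.lt_or_ge n 2 with hn | hn
  · interval_cases n
    · rw [← hA]; exact le_add_left (by omega)
    · rw [← hB]; exact le_add_left (by omega)
  · have hcn := hc n
    dsimp only at hcn
    rw [hg n (hκ n hn)] at hcn
    exact hcn.trans (add_le_add (Nat.pow_le_pow_right (by omega) (by omega)) (by omega))

/-- **p-bounded `dc(PER)` forces p-bounded `dc(CL_{·, κ ·})`** (characteristic `≠ 2`; Valiant's completeness of the
permanent, `isVNPComplete_perPoly_holds`, applied to the `VNP` clique family `exists_isVNPFamily_cliquePoly`). [folklore] -/
theorem isPBounded_dc_cliquePoly_of_perPoly (h2 : ringChar F ≠ 2) (κ : ℕ → ℕ) (hκ : ∀ n ≥ 2, 2 ≤ κ n)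
    (hper : IsPBounded fun n => dc (perPoly (Fin n) F)) : IsPBounded fun n => dc (cliquePoly n F (κ n)) := by
  obtain ⟨g, hg, hgcl⟩ := exists_isVNPFamily_cliquePoly F κ
  exact isPBounded_dc_cliquePoly_of_eventuallyEq F κ hκ hgcl
    (isPBounded_dc_of_isPProjection F ((isVNPComplete_perPoly_holds F h2).2 _ _ hg) hper)

/-- **p-bounded `dc(HC)` forces p-bounded `dc(CL_{·, κ ·})`** (every characteristic; Valiant's completeness of the
Hamiltonian-cycle family, `isVNPComplete_hcPoly_holds`). [folklore] -/
theorem isPBounded_dc_cliquePoly_of_hcPoly (κ : ℕ → ℕ) (hκ : ∀ n ≥ 2, 2 ≤ κ n)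
    (hhc : IsPBounded fun n => dc (hcPoly (Fin n) F)) : IsPBounded fun n => dc (cliquePoly n F (κ n)) := by
  obtain ⟨g, hg, hgcl⟩ := exists_isVNPFamily_cliquePoly F κ
  exact isPBounded_dc_cliquePoly_of_eventuallyEq F κ hκ hgcl
    (isPBounded_dc_of_isPProjection F ((isVNPComplete_hcPoly_holds F).2 _ _ hg) hhc)

end Transfer

/-! ### §2 The crux implies Valiant's hypothesis -/

section Headline

/-- **The crux forbids p-bounded `dc` of its clique polynomials**, over every field: `LinAlgGateBlind` gives
`m^c < dc(CL_{m,⌈m^δ⌉})` eventually for every `c` (`Negative.determinantalComplexity_cliquePoly_of_linAlgGateBlind`),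
and `n^c + c ≤ n^{c+1}` for `n ≥ 2`. [folklore] -/
theorem not_isPBounded_dc_cliquePoly_of_linAlgGateBlind
    (h : Summit.PneNP.PneNP.Theses.ConvexRankGates.LinAlgGateBlind) :
    ∃ δ : ℝ, 0 < δ ∧ δ < 1 / 2 ∧ ∀ (F : Type) [Field F],
      ¬ IsPBounded fun n => dc (cliquePoly n F ⌈(n : ℝ) ^ δ⌉₊) := by
  obtain ⟨δ, hδ0, hδ1, hB⟩ := determinantalComplexity_cliquePoly_of_linAlgGateBlind h
  refine ⟨δ, hδ0, hδ1, fun F _ => ?_⟩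
  rintro ⟨c, hc⟩
  obtain ⟨n, hn, hlt⟩ := ((hB F (c + 1)).and (eventually_ge_atTop 2)).exists
  have hpow : 2 ^ c ≤ n ^ c := Nat.pow_le_pow_left hlt c
  have hc2 : c < 2 ^ c := Nat.lt_two_pow_self
  have h1 : n ^ c + c ≤ n ^ (c + 1) :=
    calc n ^ c + c ≤ n ^ c + n ^ c := by omega
      _ = 2 * n ^ c := by ring
      _ ≤ n * n ^ c := Nat.mul_le_mul_right _ hlt
      _ = n ^ (c + 1) := by ring
  exact absurd ((hc n).trans h1) (not_le.2 hn)

/-- The crux schedule `⌈n^δ⌉₊` is `≥ 2` from `n = 2` on (`δ > 0`). [folklore] -/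
theorem two_le_ceil_rpow_of_two_le {δ : ℝ} (hδ : 0 < δ) {n : ℕ} (hn : 2 ≤ n) : 2 ≤ ⌈(n : ℝ) ^ δ⌉₊ :=
  Summit.PneNP.PneNP.Theorems.CliqueExtLowerBound.Negative.two_le_ceil_rpow hδ hn

/-- **The crux implies `DcPerSuperpolynomial F` over every field `F` of characteristic `≠ 2`** (pnp.S05, the
permanent-versus-determinant form of Valiant's hypothesis: `dc(PER_n)` is not polynomially bounded). [folklore] -/
theorem dcPerSuperpolynomial_of_linAlgGateBlind : Summit.PneNP.PneNP.Theses.ConvexRankGates.LinAlgGateBlind → ∀ (F : Type) [Field F], ringChar F ≠ 2 → Literature.Computability.AlgebraicComplexity.DcPerSuperpolynomial F := by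
  intro h F _ h2
  obtain ⟨δ, hδ0, -, hB⟩ := not_isPBounded_dc_cliquePoly_of_linAlgGateBlind h
  exact fun hper => hB F (isPBounded_dc_cliquePoly_of_perPoly F h2 _
    (fun n hn => two_le_ceil_rpow_of_two_le hδ0 hn) hper)

/-- **The crux implies VALIANT'S HYPOTHESIS over `ℂ`**: `DcPerSuperpolynomialComplex` (Valiant 1979; Landsberg 2017,
Conj. 1.2.4.2; the tree's registered open statement pnp.S05 over `ℂ`). [folklore] -/
theorem dcPerSuperpolynomialComplex_of_linAlgGateBlind
    (h : Summit.PneNP.PneNP.Theses.ConvexRankGates.LinAlgGateBlind) : DcPerSuperpolynomialComplex :=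
  dcPerSuperpolynomial_of_linAlgGateBlind h ℂ (by rw [ringChar.eq_zero]; decide)

/-- **In EVERY characteristic the crux implies that `dc(HC_n)` is not polynomially bounded** — the Hamiltonian-cycle
family is `VNP`-complete over every field, so this is `VNP_F ⊄ VBP_F` for every field `F`, characteristic `2` (where the
permanent form is void, `Literature.Barriers.ValiantsHypothesis.not_dcPerSuperpolynomial_of_charTwo`) included. [folklore] -/
theorem dc_hcPoly_not_isPBounded_of_linAlgGateBlind : Summit.PneNP.PneNP.Theses.ConvexRankGates.LinAlgGateBlind → ∀ (F : Type) [Field F], ¬ Literature.Computability.AlgebraicComplexity.IsPBounded fun n => Literature.Computability.AlgebraicComplexity.determinantalComplexity (Literature.Computability.AlgebraicComplexity.hcPoly (Fin n) F) := by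
  intro h F _
  obtain ⟨δ, hδ0, -, hB⟩ := not_isPBounded_dc_cliquePoly_of_linAlgGateBlind h
  exact fun hhc => hB F (isPBounded_dc_cliquePoly_of_hcPoly F _ (fun n hn => two_le_ceil_rpow_of_two_le hδ0 hn) hhc)

end Headline

end

end Summit.PneNP.PneNP.Theorems.LinAlgGateBlindValiant
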